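import Literature.MeasureTheory.Group.InvariantQuotientOrbitalTransport
import HarnessLib

/-!
# Orbital integrals against quotient measures are EQUAL along isomorphisms up to conjugacy:
# `∫_{G'/C(γ₂)} F(y γ₂ y⁻¹) d(ν'/ρ₂) = ∫_{G/C(γ)} F(e(x γ x⁻¹)) d(ν/ρ)` for `q e(γ) q⁻¹ = γ₂`
(Gelbart, *Automorphic forms on adele groups* (1975), §10, pp. 154–155: the factors
`∫_{B_S \ G_S} f * f^*(x⁻¹ γ x) dx` of (10.14) and (10.15) coincide through `G'_S = G_S`;
Deitmar–Echterhoff (2014), Thm. 1.5.3 for the canonical quotient measure)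

Topic `MeasureTheory/Group`; namespace `Literature.MeasureTheory.Group`; theorems only (no
definition, no named fact, no instance visible to importers). `InvariantQuotientOrbitalTransport`
compares orbital integrals along a bicontinuous isomorphism `e : G ≃* G'` with `q e(γ) q⁻¹ = γ₂` for
ARBITRARY invariant measures, up to an unspecified constant `c ≠ 0`. For the canonical quotient
measures `ν/ρ = quotientMeasure` (`InvariantQuotientExistence`) of Haar measures corresponding under
the isomorphisms — `ν' = e_* ν` on the groups (both two-sided invariant), `ρ₂ = (conj(q) ∘ e)_* ρ` on the
centralisers `C(γ) → C(γ₂)` — the constant is `1`: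

* `map_conj_eq_self` — a two-sided Haar measure is invariant under inner automorphisms;
* `lintegral_descConj_quotientMeasure_eq_of_conj_apply_eq` (`[0, ∞]`-valued) and
  `integral_descConj_quotientMeasure_eq_of_conj_apply_eq` (Banach-valued):
  `∫_{G'/C(γ₂)} F(y γ₂ y⁻¹) d(ν'/ρ₂) = ∫_{G/C(γ)} F(e(x γ x⁻¹)) d(ν/ρ)` for every `F`
  (naturality of the quotient measure along `conj(q) ∘ e`, `InvariantQuotientTransport`, then
  invariance of `ν/ρ` under `x ↦ (e⁻¹ q) x`).

With `G = G'^S = D^{S,×}`, `G' = G^S`, `e = Φ` (`QuaternionAdeleAwaySplitting`) and `q` from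
`Quat.exists_conj_apply_awayFromPlaces_inclAdelic_eq` this is the equality of the away-from-`S`
orbital integrals of matched classes for corresponding Haar measures. Part of the inline (D-0026)
decomposition of `Literature.NumberTheory.Automorphic.strong_multiplicity_one_quaternionUnits`.

## References

* S. Gelbart, *Automorphic forms on adele groups*, Ann. of Math. Studies 83 (1975), §10,
  pp. 154–155 [Gelbart1975].
* A. Deitmar, S. Echterhoff, *Principles of Harmonic Analysis*, 2nd ed. (2014), Thm. 1.5.3
  [DeitmarEchterhoff2014].
-/

noncomputable section

open MeasureTheory MeasureTheory.Measure Topology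
open scoped NNReal ENNReal

namespace Literature.MeasureTheory.Group

/-! ### Two-sided Haar measures are invariant under inner automorphisms -/

section Conj

variable {G : Type*} [Group G] [MeasurableSpace G] [MeasurableMul G]

/-- **`conj(q)_* ν = ν`** for a measure `ν` on `G` which is both left and right invariant
(`conj(q) = (· q⁻¹) ∘ (q ·)`). [folklore] -/
theorem map_conj_eq_self (ν : Measure G) [ν.IsMulLeftInvariant] [ν.IsMulRightInvariant] (q : G) :
    Measure.map (MulAut.conj q) ν = ν := by
  have h1 : (MulAut.conj q : G → G) = (fun x => x * q⁻¹) ∘ fun x => q * x := funext fun x => rfl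
  rw [h1, ← Measure.map_map (measurable_mul_const q⁻¹) (measurable_const_mul q), map_mul_left_eq_self,
    map_mul_right_eq_self]

end Conj

section Compat

variable {G G' : Type*} [Group G] [Group G'] (e : G ≃* G') {γ : G} {γ₂ : G'} (q : G')

/-- The compatibility of `conj(q) ∘ e` with the centralisers: `(conj(q) ∘ e)(C(γ)) = C(γ₂)`. [folklore] -/
theorem forall_trans_conj_apply_mem_centralizer_iff (hq : q * e γ * q⁻¹ = γ₂) :
    ∀ g : G, (e.trans (MulAut.conj q)) g ∈ Subgroup.centralizer ({γ₂} : Set G') ↔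
      g ∈ Subgroup.centralizer ({γ} : Set G) :=
  forall_apply_mem_centralizer_singleton_iff_of_eq (e.trans (MulAut.conj q)) (by rw [← hq]; rfl)

end Compat

/-! ### Orbital integrals against quotient measures along an isomorphism, up to conjugacy -/

section TransportNormalized

variable {G G' : Type*} [Group G] [Group G'] [TopologicalSpace G] [TopologicalSpace G']
  [IsTopologicalGroup G] [IsTopologicalGroup G'] [LocallyCompactSpace G] [LocallyCompactSpace G']
  [SecondCountableTopology G] [SecondCountableTopology G'] [T2Space G] [T2Space G']
  [MeasurableSpace G] [BorelSpace G] [MeasurableSpace G'] [BorelSpace G']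
  (e : G ≃* G') (he : Continuous e) (hes : Continuous e.symm) {γ : G} {γ₂ : G'} (q : G')
  (hq : q * e γ * q⁻¹ = γ₂)
  (hC : IsClosed ((Subgroup.centralizer ({γ} : Set G) : Subgroup G) : Set G))
  (hC₂ : IsClosed ((Subgroup.centralizer ({γ₂} : Set G') : Subgroup G') : Set G'))
  [MeasurableSpace (G ⧸ Subgroup.centralizer ({γ} : Set G))] [BorelSpace (G ⧸ Subgroup.centralizer ({γ} : Set G))]
  [MeasurableSpace (G' ⧸ Subgroup.centralizer ({γ₂} : Set G'))]
  [BorelSpace (G' ⧸ Subgroup.centralizer ({γ₂} : Set G'))]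
  (ρ : Measure (Subgroup.centralizer ({γ} : Set G))) [ρ.IsMulLeftInvariant] [IsFiniteMeasureOnCompacts ρ]
  [ρ.IsOpenPosMeasure] [ρ.IsInvInvariant] [SFinite ρ]
  (ρ₂ : Measure (Subgroup.centralizer ({γ₂} : Set G'))) [ρ₂.IsMulLeftInvariant] [IsFiniteMeasureOnCompacts ρ₂]
  [ρ₂.IsOpenPosMeasure] [ρ₂.IsInvInvariant] [SFinite ρ₂]
  (ν : Measure G) [IsHaarMeasure ν] [ν.IsMulRightInvariant]
  (ν' : Measure G') [IsHaarMeasure ν'] [ν'.IsMulRightInvariant]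

include hq in
/-- **Orbital integrals against quotient measures along an isomorphism, up to conjugacy — with
equality** (`[0, ∞]`-valued form). For a bicontinuous `e : G ≃* G'`, `q e(γ) q⁻¹ = γ₂`, two-sided Haar
measures `ν`, `ν' = e_* ν`, and Haar measures `ρ` on `C(γ)`, `ρ₂ = (conj(q) ∘ e)_* ρ` on `C(γ₂)`:
`∫⁻_{G'/C(γ₂)} F(y γ₂ y⁻¹) d(ν'/ρ₂) = ∫⁻_{G/C(γ)} F(e(x γ x⁻¹)) d(ν/ρ)` for every `F ≥ 0` (no measurability needed)
(naturality of the quotient measure along `conj(q) ∘ e` — note `(conj(q) ∘ e)_* ν = conj(q)_* ν' = ν'` —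
then invariance of `ν/ρ` under `x ↦ (e⁻¹ q) x`). Gelbart (1975), p. 155: "`G_S = G'_S`" makes the
away-from-`S` factors of (10.14) and (10.15) equal. [cite: Gelbart1975, pp. 154–155] [cite: DeitmarEchterhoff2014, Thm. 1.5.3] -/
theorem lintegral_descConj_quotientMeasure_eq_of_conj_apply_eq
    (hρ₂ : ρ₂ = Measure.map (subgroupCongrHomeomorph (e.trans (MulAut.conj q)) _ _
      (forall_trans_conj_apply_mem_centralizer_iff e q hq)
      (((continuous_const.mul continuous_id).mul continuous_const).comp he)
      (hes.comp ((continuous_const.mul continuous_id).mul continuous_const))) ρ)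
    (hν' : ν' = Measure.map e ν) (F : G' → ℝ≥0∞) :
    ∫⁻ y, descConj γ₂ (Subgroup.centralizer ({γ₂} : Set G')) (centralizer_comm γ₂) F y
        ∂quotientMeasure (Subgroup.centralizer ({γ₂} : Set G')) ρ₂ hC₂ ν' =
      ∫⁻ x, descConj γ (Subgroup.centralizer ({γ} : Set G)) (centralizer_comm γ) (F ∘ e) x
        ∂quotientMeasure (Subgroup.centralizer ({γ} : Set G)) ρ hC ν := by
  haveI : IsClosed ((Subgroup.centralizer ({γ} : Set G) : Subgroup G) : Set G) := hC
  haveI : IsClosed ((Subgroup.centralizer ({γ₂} : Set G') : Subgroup G') : Set G') := hC₂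
  subst hq
  set e₂ : G ≃* G' := e.trans (MulAut.conj q) with he₂
  have hec : Continuous e₂ := ((continuous_const.mul continuous_id).mul continuous_const).comp he
  have hes₂ : Continuous e₂.symm := hes.comp ((continuous_const.mul continuous_id).mul continuous_const)
  have hmc : Measurable (MulAut.conj q : G' → G') := ((continuous_const.mul continuous_id).mul continuous_const).measurable
  have hν₂ : ν' = Measure.map e₂ ν := by
    rw [he₂, MulEquiv.coe_trans, ← Measure.map_map hmc he.measurable, ← hν']
    exact (map_conj_eq_self ν' q).symm
  have key := lintegral_descConj_quotientMeasure_eq_of_mulEquiv e₂ hec hes₂ (Subgroup.centralizer ({γ} : Set G))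
    (Subgroup.centralizer ({q * e γ * q⁻¹} : Set G')) (forall_trans_conj_apply_mem_centralizer_iff e q rfl)
    (hH := hC) (hH' := hC₂) ρ ρ₂ ν ν' hρ₂ hν₂ (centralizer_comm γ) (centralizer_comm (q * e γ * q⁻¹)) F
  rw [show (∫⁻ y, descConj (q * e γ * q⁻¹) (Subgroup.centralizer ({q * e γ * q⁻¹} : Set G')) (centralizer_comm _) F y
        ∂quotientMeasure (Subgroup.centralizer ({q * e γ * q⁻¹} : Set G')) ρ₂ hC₂ ν') =
      ∫⁻ x, descConj γ (Subgroup.centralizer ({γ} : Set G)) (centralizer_comm γ) (F ∘ e₂) x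
        ∂quotientMeasure (Subgroup.centralizer ({γ} : Set G)) ρ hC ν from key]
  -- `F ∘ e₂ = F ∘ conj(q) ∘ e`: its orbital integrand is the `e⁻¹ q`-translate of that of `F ∘ e`
  have h1 : ∀ x, descConj γ (Subgroup.centralizer ({γ} : Set G)) (centralizer_comm γ) (F ∘ e₂) x =
      descConj γ (Subgroup.centralizer ({γ} : Set G)) (centralizer_comm γ) (F ∘ e) (e.symm q • x) := fun x =>
    descConj_comp_conj_comp_eq_descConj_comp_smul e q γ F x
  simp_rw [h1]
  exact (measurePreserving_smul (e.symm q) (quotientMeasure (Subgroup.centralizer ({γ} : Set G)) ρ hC ν)).lintegral_comp_emb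
    (measurableEmbedding_const_smul (e.symm q)) _

include hq in
/-- **The same, Banach-valued**: `∫_{G'/C(γ₂)} F(y γ₂ y⁻¹) d(ν'/ρ₂) = ∫_{G/C(γ)} F(e(x γ x⁻¹)) d(ν/ρ)` for
every `F` (both sides use the same convention for non-integrable `F`).
[cite: Gelbart1975, pp. 154–155] [cite: DeitmarEchterhoff2014, Thm. 1.5.3] -/
theorem integral_descConj_quotientMeasure_eq_of_conj_apply_eq
    (hρ₂ : ρ₂ = Measure.map (subgroupCongrHomeomorph (e.trans (MulAut.conj q)) _ _
      (forall_trans_conj_apply_mem_centralizer_iff e q hq)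
      (((continuous_const.mul continuous_id).mul continuous_const).comp he)
      (hes.comp ((continuous_const.mul continuous_id).mul continuous_const))) ρ)
    (hν' : ν' = Measure.map e ν) {E : Type*} [NormedAddCommGroup E] [NormedSpace ℝ E] (F : G' → E) :
    ∫ y, descConj γ₂ (Subgroup.centralizer ({γ₂} : Set G')) (centralizer_comm γ₂) F y
        ∂quotientMeasure (Subgroup.centralizer ({γ₂} : Set G')) ρ₂ hC₂ ν' =
      ∫ x, descConj γ (Subgroup.centralizer ({γ} : Set G)) (centralizer_comm γ) (F ∘ e) x
        ∂quotientMeasure (Subgroup.centralizer ({γ} : Set G)) ρ hC ν := by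
  haveI : IsClosed ((Subgroup.centralizer ({γ} : Set G) : Subgroup G) : Set G) := hC
  haveI : IsClosed ((Subgroup.centralizer ({γ₂} : Set G') : Subgroup G') : Set G') := hC₂
  subst hq
  set e₂ : G ≃* G' := e.trans (MulAut.conj q) with he₂
  have hec : Continuous e₂ := ((continuous_const.mul continuous_id).mul continuous_const).comp he
  have hes₂ : Continuous e₂.symm := hes.comp ((continuous_const.mul continuous_id).mul continuous_const)
  have hmc : Measurable (MulAut.conj q : G' → G') := ((continuous_const.mul continuous_id).mul continuous_const).measurable
  have hν₂ : ν' = Measure.map e₂ ν := by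
    rw [he₂, MulEquiv.coe_trans, ← Measure.map_map hmc he.measurable, ← hν']
    exact (map_conj_eq_self ν' q).symm
  have htr := map_cosetCongr_quotientMeasure e₂ hec hes₂ (Subgroup.centralizer ({γ} : Set G))
    (Subgroup.centralizer ({q * e γ * q⁻¹} : Set G')) (forall_trans_conj_apply_mem_centralizer_iff e q rfl)
    (hH := hC) (hH' := hC₂) ρ ρ₂ ν ν' hρ₂ hν₂
  set ψ := cosetCongrHomeomorph e₂ (Subgroup.centralizer ({γ} : Set G)) (Subgroup.centralizer ({q * e γ * q⁻¹} : Set G'))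
    (forall_trans_conj_apply_mem_centralizer_iff e q rfl) hec hes₂ with hψ
  have hψc : (cosetCongr e₂ (Subgroup.centralizer ({γ} : Set G)) (Subgroup.centralizer ({q * e γ * q⁻¹} : Set G'))
      (forall_trans_conj_apply_mem_centralizer_iff e q rfl) : _ → _) = ψ := rfl
  rw [← htr, hψc, ← Homeomorph.toMeasurableEquiv_coe ψ, integral_map_equiv]
  have hγ₂ : e₂ γ = q * e γ * q⁻¹ := rfl
  have h1 : ∀ x, descConj (q * e γ * q⁻¹) (Subgroup.centralizer ({q * e γ * q⁻¹} : Set G')) (centralizer_comm _) F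
      (ψ.toMeasurableEquiv x) =
      descConj γ (Subgroup.centralizer ({γ} : Set G)) (centralizer_comm γ) (F ∘ e) (e.symm q • x) := fun x => by
    rw [Homeomorph.toMeasurableEquiv_coe, ← hψc, ← descConj_comp_conj_comp_eq_descConj_comp_smul e q γ F x]
    exact descConj_cosetCongr_apply e₂ hγ₂ F x
  simp_rw [h1]
  exact integral_smul_eq_self _

end TransportNormalized

end Literature.MeasureTheory.Group
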